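import Mathlib
import HarnessLib
import Summits.HubbardSuperconductivity.HubbardSuperconductivity.Theorems.KLProgrammeKLRegimeFlowReadScaleZeroDiagonalKernel
import Summits.HubbardSuperconductivity.HubbardSuperconductivity.Theorems.KLProgrammeKLRegimeFlowReadScaleZeroRainbowTrace
import Summits.HubbardSuperconductivity.HubbardSuperconductivity.Theorems.KLProgrammeKLRegimeFlowReadScaleZeroMixed
import Summits.HubbardSuperconductivity.HubbardSuperconductivity.Theorems.KLProgrammeKLRegimeCountertermMuFlow

/-!
# Route `KLProgramme`, crux K3 — gen-8 ENGINE-FLOW child (stmt-HubbardSuperconductivity-20437 `KLRegimeEngineV17F2`), stub (C) at `n = 0`,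
# located item #22a «(C)-SCALE0-PT2», step (π3b-ii): THE DIAGONAL QUADRATIC `D` — a grid-diagonal `ψ⁺ψ⁻` element whose interpolated symbol is a
# CONSTANT, absorbing the whole coincident-point two-leg entry of `W₀ − R₃` into the momentum-side piece `W_b' := Q_c + D`

Seat hubbard-kl-k3c5-p1 (g13; owner of #22a).  With π3a (p618339) the coincident entry of the scale-`0` output is
`d(p,σ) + kernel₂R₃`, `d(p,σ) = ½Uε·t₀ + ½(Uε)²·t₀·Σ_q A((p,σ̄)⁺,(q,σ̄)⁻)A((q,σ̄)⁺,(p,σ̄)⁻)` (`ε = β/4M`), and the chain `Q_c` (π2b) has the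
coincident entry `½c·t₀`.  For ANY coefficient function `e : GridPoint × spin → ℂ` the diagonal quadratic `D_e := Σ_{p,σ} e(p,σ)•ψ⁺_{pσ}ψ⁻_{pσ}` has
`kernel₂ D_e ((p₀,σ,+),(p₁,σ,−)) = [p₁ = p₀]·½e(p₀,σ)` (§1) and — plane waves being unimodular — the K-INDEPENDENT self-energy
`Σ[map S D_e](K,σ) = (βL²)⁻¹·Σ_p e(p,σ)` (§2), hence a CONSTANT localised symbol `c_e = Re(Σ_{p,σ} e(p,σ))/(2βL²)` and the interpolant
`evalM (symInterp L (loc(map S D_e))) = c_e` (§2).  With `e := 2(d − ½c·t₀)` the split of record becomes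
`W₀ = W_a' + W_b'`, `W_b' := Q_c + D_e`, `W_a' := W₀ − Q_c − D_e`, with `kernel₂ W_a'` = pure sunset off the coincident point and `= kernel₂R₃` AT it
(§4), so that the MIXED door's `W_b'`-hypotheses will read (assembly file, next): `|H(γ₀θ)| ≤ |c_e| + A₀`, `|H(γ₀θ) − c_e| ≤ A₀`, jets `≤ bell4 A D k`
(from p615543 + `evalM_symInterp_locSymbol_add` + `iteratedDeriv_const_add`), where `|c_e| ≤ 4|U| + (2048 + 64ε)·U²` by `|t₀| ≤ 4` (p616988) and the
rainbow trace `≤ 512/ε` (p618793) (§3) — the door's `hv := 4`, `h0 := 2048 + 64ε`, `τ := c_e`.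

Proofs only; no definitions (the element `D_e` and the constant `c_e` are written out); nothing asserts any stub of 20437, K3 or superconductivity.
References: BGM 2006 §2.1 (2.3)–(2.6), §2.2 (2.14) [cite: BenfattoGiulianiMastropietro2006]; Salmhofer 1999 §4.3 (4.95) [cite: Salmhofer1999].
-/

noncomputable section

namespace Summit.HubbardSuperconductivity.HubbardSuperconductivity.Theorems.KLRegimeSplit

set_option linter.dupNamespace false -- summit = problem name (single-conjunct summit), D-0017

open Real Finset Complex Literature.MathematicalPhysics.QuantumLattice Literature.Probability.LatticeModels GrassmannAlgebra Matrix
open Summit.HubbardSuperconductivity.HubbardSuperconductivity.Theorems.EngineV8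
open Summit.HubbardSuperconductivity.HubbardSuperconductivity.Theorems.TwoLegFourier (selfEnergy_finset_sum)
open scoped ComplexConjugate

/-! ## §1 The two-leg kernel of a diagonal quadratic -/

section Diag

variable {L N : ℕ} [NeZero L]

/-- **`kernel₂ (Σ_{p,σ} e(p,σ)•ψ⁺_{pσ}ψ⁻_{pσ}) ((p₀,σ₀,+),(p₁,σ₀,−)) = [p₁ = p₀]·½·e(p₀,σ₀)`**. -/
theorem kernel_two_diagQuadratic (e : GridPoint L N → Fin 2 → ℂ) (p₀ p₁ : GridPoint L N) (σ₀ : Fin 2) :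
    kernel ℂ (∑ p : GridPoint L N, ∑ σ : Fin 2,
        e p σ • (gen ℂ (((p, σ), 0) : GridLeg (GridPoint L N)) * gen ℂ (((p, σ), 1) : GridLeg (GridPoint L N)))) 2
      (fun i => ((![p₀, p₁] i, σ₀), i)) = if p₁ = p₀ then (2 : ℂ)⁻¹ * e p₀ σ₀ else 0 := by
  rw [twoLegString_eq]
  simp only [kernel_sum, kernel_smul, kernel_two_gen_mul_gen, Matrix.cons_val_zero, Matrix.cons_val_one, Prod.mk.injEq, and_true,
    zero_ne_one, and_false, if_false, one_ne_zero, mul_zero, sub_zero]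
  rw [Finset.sum_eq_single_of_mem p₀ (Finset.mem_univ _) (fun p _ hp => by
        have h : ¬p₀ = p := fun h => hp h.symm
        simp only [h, false_and, if_false, zero_mul, mul_zero, Finset.sum_const_zero]),
    Finset.sum_eq_single_of_mem σ₀ (Finset.mem_univ _) (fun σ _ hσ => by
        have h : ¬σ₀ = σ := fun h => hσ h.symm
        simp only [h, and_false, if_false, mul_zero])]
  by_cases h : p₁ = p₀
  · subst h; simp [mul_comm]
  · simp [h]

end Diag

/-! ## §2 The self-energy of the grid image of a diagonal quadratic is `K`-independent -/

section Symbol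

variable {L M N : ℕ} [NeZero L] [NeZero M]

omit [NeZero M] in
/-- **`Σ[map S_N (ψ⁺_{pσ'}ψ⁻_{pσ'})](K,σ) = [σ' = σ]·(βL²)⁻¹`** — independent of `K` (plane waves are unimodular: `conj(e⁺_K(p))·conj(e⁻_K(p)) = 1`). -/
theorem selfEnergy_map_gridSub_gen_mul_gen_self (β : ℝ) (p : GridPoint L N) (σ σ' : Fin 2) (K : FreqMomentum L M) :
    selfEnergy L M β (ExteriorAlgebra.map (Matrix.toLin' (hubbardGridSub L M β N))
        (gen ℂ (((p, σ'), 0) : GridLeg (GridPoint L N)) * gen ℂ (((p, σ'), 1) : GridLeg (GridPoint L N)))) K σ =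
      if σ' = σ then (((1 / (β * (L : ℝ) ^ 2) : ℝ) : ℂ)) else 0 := by
  rw [selfEnergy_map_gridSub_gen_mul_gen]
  split_ifs with hσ
  · have h1 : conj (vertexPlaneWave L M β 0 K p.2 (gridTime β N p.1)) * conj (vertexPlaneWave L M β 1 K p.2 (gridTime β N p.1)) = 1 := by
      rw [conj_vertexPlaneWave_zero_mul_one, sub_self]; simp
    rcases eq_or_ne (β * (L : ℝ) ^ 2) 0 with h0 | h0
    · simp [h0]
    · have h0c : ((β * (L : ℝ) ^ 2 : ℝ) : ℂ) ≠ 0 := by exact_mod_cast h0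
      calc _ = ((β * (L : ℝ) ^ 2 : ℝ) : ℂ) * (((1 / (β * (L : ℝ) ^ 2) : ℝ) : ℂ)) ^ 2 *
            (conj (vertexPlaneWave L M β 0 K p.2 (gridTime β N p.1)) * conj (vertexPlaneWave L M β 1 K p.2 (gridTime β N p.1))) := by ring
        _ = _ := by rw [h1, mul_one]; push_cast; field_simp
  · rfl

omit [NeZero M] in
/-- **`Σ[map S_N (Σ_{p,σ'} e(p,σ')•ψ⁺_{pσ'}ψ⁻_{pσ'})](K,σ) = (βL²)⁻¹·Σ_p e(p,σ)`** — independent of the frequency–momentum `K`. -/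
theorem selfEnergy_map_gridSub_diagQuadratic (β : ℝ) (e : GridPoint L N → Fin 2 → ℂ) (K : FreqMomentum L M) (σ : Fin 2) :
    selfEnergy L M β (ExteriorAlgebra.map (Matrix.toLin' (hubbardGridSub L M β N))
        (∑ p : GridPoint L N, ∑ σ' : Fin 2,
          e p σ' • (gen ℂ (((p, σ'), 0) : GridLeg (GridPoint L N)) * gen ℂ (((p, σ'), 1) : GridLeg (GridPoint L N))))) K σ =
      (((1 / (β * (L : ℝ) ^ 2) : ℝ) : ℂ)) * ∑ p : GridPoint L N, e p σ := by
  simp only [map_sum, map_smul, selfEnergy_finset_sum, selfEnergy_smul', selfEnergy_map_gridSub_gen_mul_gen_self, mul_ite, mul_zero,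
    Finset.sum_ite_eq', Finset.mem_univ, if_true]
  rw [Finset.mul_sum]
  exact Finset.sum_congr rfl fun p _ => mul_comm _ _

/-- **The localised symbol of the image of a diagonal quadratic is the CONSTANT `c_e = Re(Σ_{p,σ} e(p,σ))/(2βL²)`.** -/
theorem locSymbol_map_gridSub_diagQuadratic (β : ℝ) (e : GridPoint L N → Fin 2 → ℂ) :
    (fun k : TorusSite 2 L => (∑ σ : Fin 2, ((selfEnergy L M β (ExteriorAlgebra.map (Matrix.toLin' (hubbardGridSub L M β N))
        (∑ p : GridPoint L N, ∑ σ' : Fin 2,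
          e p σ' • (gen ℂ (((p, σ'), 0) : GridLeg (GridPoint L N)) * gen ℂ (((p, σ'), 1) : GridLeg (GridPoint L N))))) (omega0 M, k) σ).re +
      (selfEnergy L M β (ExteriorAlgebra.map (Matrix.toLin' (hubbardGridSub L M β N))
        (∑ p : GridPoint L N, ∑ σ' : Fin 2,
          e p σ' • (gen ℂ (((p, σ'), 0) : GridLeg (GridPoint L N)) * gen ℂ (((p, σ'), 1) : GridLeg (GridPoint L N))))) ((omega0 M).rev, k) σ).re)) / 4) =
      fun _ => ((∑ σ : Fin 2, ((((1 / (β * (L : ℝ) ^ 2) : ℝ) : ℂ)) * ∑ p : GridPoint L N, e p σ).re)) / 2 := by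
  funext k
  simp only [selfEnergy_map_gridSub_diagQuadratic]
  rw [Fin.sum_univ_two, Fin.sum_univ_two]
  ring

/-- **The interpolant of the diagonal quadratic's symbol is that constant** (`I_L` reproduces constants). -/
theorem evalM_symInterp_locSymbol_map_gridSub_diagQuadratic (β : ℝ) (e : GridPoint L N → Fin 2 → ℂ) :
    evalM (symInterp L (fun k : TorusSite 2 L => (∑ σ : Fin 2, ((selfEnergy L M β (ExteriorAlgebra.map (Matrix.toLin' (hubbardGridSub L M β N))
        (∑ p : GridPoint L N, ∑ σ' : Fin 2,
          e p σ' • (gen ℂ (((p, σ'), 0) : GridLeg (GridPoint L N)) * gen ℂ (((p, σ'), 1) : GridLeg (GridPoint L N))))) (omega0 M, k) σ).re +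
      (selfEnergy L M β (ExteriorAlgebra.map (Matrix.toLin' (hubbardGridSub L M β N))
        (∑ p : GridPoint L N, ∑ σ' : Fin 2,
          e p σ' • (gen ℂ (((p, σ'), 0) : GridLeg (GridPoint L N)) * gen ℂ (((p, σ'), 1) : GridLeg (GridPoint L N))))) ((omega0 M).rev, k) σ).re)) / 4)) =
      fun _ => ((∑ σ : Fin 2, ((((1 / (β * (L : ℝ) ^ 2) : ℝ) : ℂ)) * ∑ p : GridPoint L N, e p σ).re)) / 2 := by
  rw [locSymbol_map_gridSub_diagQuadratic, evalM_symInterp_const]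

end Symbol

/-! ## §3 The size of the constant for the coefficient of record -/

section Size

variable {L M : ℕ} [NeZero L] [NeZero M]

/-- **THE COEFFICIENT OF RECORD AND ITS SIZE**: with `A = contr (SᵀC⁰S)`, `t₀` the scale-`0` tadpole, `ε = β/4M`, for
`e(p,σ) := 2·(½Uε·t₀ + ½(Uε)²·t₀·Σ_q A((p,σ̄)⁺,(q,σ̄)⁻)A((q,σ̄)⁺,(p,σ̄)⁻) − ½(Uε)²t₀²·t₀)` (twice the coincident entry of `W₀ − R₃ − Q_c`):
`‖e(p,σ)‖ ≤ 4|U|ε + 2048·U²ε + 64·U²ε²` (`0 < β`) — uniformly in `β, L, M, μ, p, σ`. -/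
theorem norm_diagCoeff_le {β : ℝ} (hβ : 0 < β) (U μ : ℝ) (p : GridPoint L (2 * (2 * M))) (σ : Fin 2) :
    ‖(2 : ℂ) * ((2 : ℂ)⁻¹ * (((U * (β / (2 * (2 * M) : ℕ)) : ℝ) : ℂ) *
        (-∑ k : FreqMomentum L M, ((1 / (β * (L : ℝ) ^ 2) : ℝ) : ℂ) ^ 2 * uvSymbolCT L M β μ 0 klE0 (k, 0))) +
      (2 : ℂ)⁻¹ * (((U * (β / (2 * (2 * M) : ℕ)) : ℝ) : ℂ) ^ 2 *
        ((-∑ k : FreqMomentum L M, ((1 / (β * (L : ℝ) ^ 2) : ℝ) : ℂ) ^ 2 * uvSymbolCT L M β μ 0 klE0 (k, 0)) *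
          ∑ q : GridPoint L (2 * (2 * M)),
            contr ℂ ((hubbardGridSub L M β (2 * (2 * M))).transpose * hubbardCovAboveCT L M β μ 0 0 klE0 *
                hubbardGridSub L M β (2 * (2 * M))) (((p, σ.rev), 0) : GridLeg (GridPoint L (2 * (2 * M)))) ((q, σ.rev), 1) *
              contr ℂ ((hubbardGridSub L M β (2 * (2 * M))).transpose * hubbardCovAboveCT L M β μ 0 0 klE0 *
                hubbardGridSub L M β (2 * (2 * M))) (((q, σ.rev), 0) : GridLeg (GridPoint L (2 * (2 * M)))) ((p, σ.rev), 1))) -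
      (2 : ℂ)⁻¹ * ((((U * (β / (2 * (2 * M) : ℕ)) : ℝ) : ℂ) ^ 2 *
          ((-∑ k : FreqMomentum L M, ((1 / (β * (L : ℝ) ^ 2) : ℝ) : ℂ) ^ 2 * uvSymbolCT L M β μ 0 klE0 (k, 0)) *
           (-∑ k : FreqMomentum L M, ((1 / (β * (L : ℝ) ^ 2) : ℝ) : ℂ) ^ 2 * uvSymbolCT L M β μ 0 klE0 (k, 0)))) *
        (-∑ k : FreqMomentum L M, ((1 / (β * (L : ℝ) ^ 2) : ℝ) : ℂ) ^ 2 * uvSymbolCT L M β μ 0 klE0 (k, 0))))‖ ≤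
      4 * |U| * (β / ((2 * (2 * M) : ℕ) : ℝ)) + 2048 * U ^ 2 * (β / ((2 * (2 * M) : ℕ) : ℝ)) +
        64 * U ^ 2 * (β / ((2 * (2 * M) : ℕ) : ℝ)) ^ 2 := by
  have hN : (0 : ℝ) < ((2 * (2 * M) : ℕ) : ℝ) := by have := NeZero.ne M; positivity
  set ε : ℝ := β / ((2 * (2 * M) : ℕ) : ℝ) with hε
  have hε0 : 0 < ε := by positivity
  set t : ℂ := -∑ k : FreqMomentum L M, ((1 / (β * (L : ℝ) ^ 2) : ℝ) : ℂ) ^ 2 * uvSymbolCT L M β μ 0 klE0 (k, 0) with ht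
  set R : ℂ := ∑ q : GridPoint L (2 * (2 * M)),
      contr ℂ ((hubbardGridSub L M β (2 * (2 * M))).transpose * hubbardCovAboveCT L M β μ 0 0 klE0 *
          hubbardGridSub L M β (2 * (2 * M))) (((p, σ.rev), 0) : GridLeg (GridPoint L (2 * (2 * M)))) ((q, σ.rev), 1) *
        contr ℂ ((hubbardGridSub L M β (2 * (2 * M))).transpose * hubbardCovAboveCT L M β μ 0 0 klE0 *
          hubbardGridSub L M β (2 * (2 * M))) (((q, σ.rev), 0) : GridLeg (GridPoint L (2 * (2 * M)))) ((p, σ.rev), 1) with hR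
  have htn : ‖t‖ ≤ 4 := by rw [ht, norm_neg]; exact norm_scaleZero_tadpole_le_four hβ μ 0
  have hRn : ‖R‖ ≤ 512 / ε := by rw [hR, hε]; exact norm_sum_scaleZeroGridCov_mul_swap_le hβ μ p σ.rev
  have hUε : ‖(((U * ε : ℝ)) : ℂ)‖ = |U| * ε := by rw [Complex.norm_real, Real.norm_eq_abs, abs_mul, abs_of_pos hε0]
  -- the three terms
  have e1 : ‖(2 : ℂ) * ((2 : ℂ)⁻¹ * (((U * ε : ℝ)) : ℂ) * t)‖ ≤ 4 * |U| * ε := by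
    rw [show (2 : ℂ) * ((2 : ℂ)⁻¹ * (((U * ε : ℝ)) : ℂ) * t) = (((U * ε : ℝ)) : ℂ) * t by ring, norm_mul, hUε]
    calc |U| * ε * ‖t‖ ≤ |U| * ε * 4 := mul_le_mul_of_nonneg_left htn (by positivity)
      _ = 4 * |U| * ε := by ring
  have e2 : ‖(2 : ℂ) * ((2 : ℂ)⁻¹ * (((U * ε : ℝ)) : ℂ) ^ 2 * (t * R))‖ ≤ 2048 * U ^ 2 * ε := by
    rw [show (2 : ℂ) * ((2 : ℂ)⁻¹ * (((U * ε : ℝ)) : ℂ) ^ 2 * (t * R)) = (((U * ε : ℝ)) : ℂ) ^ 2 * (t * R) by ring,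
      norm_mul, norm_mul, norm_pow, hUε]
    calc (|U| * ε) ^ 2 * (‖t‖ * ‖R‖) ≤ (|U| * ε) ^ 2 * (4 * (512 / ε)) :=
          mul_le_mul_of_nonneg_left (mul_le_mul htn hRn (norm_nonneg _) (by norm_num)) (by positivity)
      _ = 2048 * U ^ 2 * ε := by rw [mul_pow, sq_abs]; field_simp; ring
  have e3 : ‖(2 : ℂ) * ((2 : ℂ)⁻¹ * ((((U * ε : ℝ)) : ℂ) ^ 2 * (t * t)) * t)‖ ≤ 64 * U ^ 2 * ε ^ 2 := by
    rw [show (2 : ℂ) * ((2 : ℂ)⁻¹ * ((((U * ε : ℝ)) : ℂ) ^ 2 * (t * t)) * t) = (((U * ε : ℝ)) : ℂ) ^ 2 * (t * t * t) by ring,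
      norm_mul, norm_mul, norm_mul, norm_pow, hUε]
    have ht3 : ‖t‖ * ‖t‖ * ‖t‖ ≤ 4 * 4 * 4 :=
      mul_le_mul (mul_le_mul htn htn (norm_nonneg _) (by norm_num)) htn (norm_nonneg _) (by norm_num)
    calc (|U| * ε) ^ 2 * (‖t‖ * ‖t‖ * ‖t‖) ≤ (|U| * ε) ^ 2 * (4 * 4 * 4) := mul_le_mul_of_nonneg_left ht3 (by positivity)
      _ = 64 * U ^ 2 * ε ^ 2 := by rw [mul_pow, sq_abs]; ring
  have hsplit : (2 : ℂ) * ((2 : ℂ)⁻¹ * ((((U * ε : ℝ)) : ℂ) * t) + (2 : ℂ)⁻¹ * ((((U * ε : ℝ)) : ℂ) ^ 2 * (t * R)) -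
      (2 : ℂ)⁻¹ * ((((U * ε : ℝ)) : ℂ) ^ 2 * (t * t) * t)) =
      (2 : ℂ) * ((2 : ℂ)⁻¹ * (((U * ε : ℝ)) : ℂ) * t) + (2 : ℂ) * ((2 : ℂ)⁻¹ * (((U * ε : ℝ)) : ℂ) ^ 2 * (t * R)) -
        (2 : ℂ) * ((2 : ℂ)⁻¹ * ((((U * ε : ℝ)) : ℂ) ^ 2 * (t * t)) * t) := by ring
  rw [hsplit]
  refine (norm_sub_le _ _).trans ((add_le_add ((norm_add_le _ _).trans (add_le_add e1 e2)) e3).trans (le_of_eq ?_))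
  ring

/-- **THE CONSTANT OF RECORD IS SMALL**: for the coefficient of record `e`, the constant symbol `c_e = (Σ_σ Re((βL²)⁻¹Σ_p e(p,σ)))/2` obeys
`|c_e| ≤ 4|U| + 2048·U² + 64·U²·ε` (`0 < β`; `#GridPoint = 4M·L²` against `(βL²)⁻¹` leaves exactly `1/ε`) — the door's `hv := 4`, `h0 := 2048 + 64ε`. -/
theorem abs_diagConst_le {β : ℝ} (hβ : 0 < β) (U μ : ℝ) :
    |(∑ σ : Fin 2, ((((1 / (β * (L : ℝ) ^ 2) : ℝ) : ℂ)) * ∑ p : GridPoint L (2 * (2 * M)),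
      ((2 : ℂ) * ((2 : ℂ)⁻¹ * (((U * (β / (2 * (2 * M) : ℕ)) : ℝ) : ℂ) *
        (-∑ k : FreqMomentum L M, ((1 / (β * (L : ℝ) ^ 2) : ℝ) : ℂ) ^ 2 * uvSymbolCT L M β μ 0 klE0 (k, 0))) +
      (2 : ℂ)⁻¹ * (((U * (β / (2 * (2 * M) : ℕ)) : ℝ) : ℂ) ^ 2 *
        ((-∑ k : FreqMomentum L M, ((1 / (β * (L : ℝ) ^ 2) : ℝ) : ℂ) ^ 2 * uvSymbolCT L M β μ 0 klE0 (k, 0)) *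
          ∑ q : GridPoint L (2 * (2 * M)),
            contr ℂ ((hubbardGridSub L M β (2 * (2 * M))).transpose * hubbardCovAboveCT L M β μ 0 0 klE0 *
                hubbardGridSub L M β (2 * (2 * M))) (((p, σ.rev), 0) : GridLeg (GridPoint L (2 * (2 * M)))) ((q, σ.rev), 1) *
              contr ℂ ((hubbardGridSub L M β (2 * (2 * M))).transpose * hubbardCovAboveCT L M β μ 0 0 klE0 *
                hubbardGridSub L M β (2 * (2 * M))) (((q, σ.rev), 0) : GridLeg (GridPoint L (2 * (2 * M)))) ((p, σ.rev), 1))) -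
      (2 : ℂ)⁻¹ * ((((U * (β / (2 * (2 * M) : ℕ)) : ℝ) : ℂ) ^ 2 *
          ((-∑ k : FreqMomentum L M, ((1 / (β * (L : ℝ) ^ 2) : ℝ) : ℂ) ^ 2 * uvSymbolCT L M β μ 0 klE0 (k, 0)) *
           (-∑ k : FreqMomentum L M, ((1 / (β * (L : ℝ) ^ 2) : ℝ) : ℂ) ^ 2 * uvSymbolCT L M β μ 0 klE0 (k, 0)))) *
        (-∑ k : FreqMomentum L M, ((1 / (β * (L : ℝ) ^ 2) : ℝ) : ℂ) ^ 2 * uvSymbolCT L M β μ 0 klE0 (k, 0)))))).re) / 2| ≤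
      4 * |U| + 2048 * U ^ 2 + 64 * U ^ 2 * (β / ((2 * (2 * M) : ℕ) : ℝ)) := by
  have hL : (0 : ℝ) < (L : ℝ) := by have := NeZero.ne L; positivity
  have hβL : 0 < β * (L : ℝ) ^ 2 := by positivity
  have hN : (0 : ℝ) < ((2 * (2 * M) : ℕ) : ℝ) := by have := NeZero.ne M; positivity
  set ε : ℝ := β / ((2 * (2 * M) : ℕ) : ℝ) with hε
  have hcard : (Fintype.card (GridPoint L (2 * (2 * M))) : ℝ) = ((2 * (2 * M) : ℕ) : ℝ) * (L : ℝ) ^ 2 := by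
    simp [GridPoint, TorusSite, Fintype.card_prod, Fintype.card_fin, ZMod.card]
  have hu : ‖(((1 / (β * (L : ℝ) ^ 2) : ℝ) : ℂ))‖ = 1 / (β * (L : ℝ) ^ 2) := by
    rw [Complex.norm_real, Real.norm_eq_abs, abs_of_pos (by positivity)]
  -- each spin block: `|Re(u·Σ_p e)| ≤ u·#pts·sup‖e‖ = (1/ε)·ε·(…)`
  have hblock : ∀ σ : Fin 2, ‖(((1 / (β * (L : ℝ) ^ 2) : ℝ) : ℂ)) * ∑ p : GridPoint L (2 * (2 * M)),
      ((2 : ℂ) * ((2 : ℂ)⁻¹ * (((U * (β / (2 * (2 * M) : ℕ)) : ℝ) : ℂ) *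
        (-∑ k : FreqMomentum L M, ((1 / (β * (L : ℝ) ^ 2) : ℝ) : ℂ) ^ 2 * uvSymbolCT L M β μ 0 klE0 (k, 0))) +
      (2 : ℂ)⁻¹ * (((U * (β / (2 * (2 * M) : ℕ)) : ℝ) : ℂ) ^ 2 *
        ((-∑ k : FreqMomentum L M, ((1 / (β * (L : ℝ) ^ 2) : ℝ) : ℂ) ^ 2 * uvSymbolCT L M β μ 0 klE0 (k, 0)) *
          ∑ q : GridPoint L (2 * (2 * M)),
            contr ℂ ((hubbardGridSub L M β (2 * (2 * M))).transpose * hubbardCovAboveCT L M β μ 0 0 klE0 *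
                hubbardGridSub L M β (2 * (2 * M))) (((p, σ.rev), 0) : GridLeg (GridPoint L (2 * (2 * M)))) ((q, σ.rev), 1) *
              contr ℂ ((hubbardGridSub L M β (2 * (2 * M))).transpose * hubbardCovAboveCT L M β μ 0 0 klE0 *
                hubbardGridSub L M β (2 * (2 * M))) (((q, σ.rev), 0) : GridLeg (GridPoint L (2 * (2 * M)))) ((p, σ.rev), 1))) -
      (2 : ℂ)⁻¹ * ((((U * (β / (2 * (2 * M) : ℕ)) : ℝ) : ℂ) ^ 2 *
          ((-∑ k : FreqMomentum L M, ((1 / (β * (L : ℝ) ^ 2) : ℝ) : ℂ) ^ 2 * uvSymbolCT L M β μ 0 klE0 (k, 0)) *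
           (-∑ k : FreqMomentum L M, ((1 / (β * (L : ℝ) ^ 2) : ℝ) : ℂ) ^ 2 * uvSymbolCT L M β μ 0 klE0 (k, 0)))) *
        (-∑ k : FreqMomentum L M, ((1 / (β * (L : ℝ) ^ 2) : ℝ) : ℂ) ^ 2 * uvSymbolCT L M β μ 0 klE0 (k, 0)))))‖ ≤
      4 * |U| + 2048 * U ^ 2 + 64 * U ^ 2 * ε := by
    intro σ
    rw [norm_mul, hu]
    have hsum := (norm_sum_le _ _).trans (Finset.sum_le_sum fun p (_ : p ∈ (Finset.univ : Finset (GridPoint L (2 * (2 * M))))) =>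
      norm_diagCoeff_le (L := L) (M := M) hβ U μ p σ)
    rw [Finset.sum_const, Finset.card_univ, nsmul_eq_mul, hcard] at hsum
    refine (mul_le_mul_of_nonneg_left hsum (by positivity)).trans (le_of_eq ?_)
    rw [hε]
    field_simp
  rw [Fin.sum_univ_two, abs_div, abs_two, div_le_iff₀ (by norm_num : (0 : ℝ) < 2)]
  have h0 := (Complex.abs_re_le_norm _).trans (hblock 0)
  have h1 := (Complex.abs_re_le_norm _).trans (hblock 1)
  exact (abs_add_le _ _).trans (by linarith)

end Size

/-! ## §4 The refined split: the coincident entry of `W_a' := W₀ − Q_c − D_e` is the order-≥3 remainder's -/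

section Split

variable {L M : ℕ} [NeZero L] [NeZero M]

/-- **AT THE COINCIDENT POINT `W_a' = W₀ − Q_c − D_e` HAS ONLY THE REMAINDER**: with the coefficient of record `e`,
`kernel₂ (W₀ − Q_c − D_e) ((p,σ,+),(p,σ,−)) = kernel₂ R₃ ((p,σ,+),(p,σ,−))`. -/
theorem kernel_two_scaleZero_effAction_sub_chain_sub_diag_self (β U μ : ℝ) (p : GridPoint L (2 * (2 * M))) (σ : Fin 2) :
    kernel ℂ (effAction ℂ ((hubbardGridSub L M β (2 * (2 * M))).transpose * hubbardCovAboveCT L M β μ 0 0 klE0 *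
          hubbardGridSub L M β (2 * (2 * M))) (hubbardGridInteraction L (2 * (2 * M)) β U) -
        (∑ p' : GridPoint L (2 * (2 * M)), ∑ q' : GridPoint L (2 * (2 * M)), ∑ σ' : Fin 2,
          ((((U * (β / (2 * (2 * M) : ℕ)) : ℝ) : ℂ) ^ 2 *
              ((-∑ k : FreqMomentum L M, ((1 / (β * (L : ℝ) ^ 2) : ℝ) : ℂ) ^ 2 * uvSymbolCT L M β μ 0 klE0 (k, 0)) *
               (-∑ k : FreqMomentum L M, ((1 / (β * (L : ℝ) ^ 2) : ℝ) : ℂ) ^ 2 * uvSymbolCT L M β μ 0 klE0 (k, 0)))) *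
            contr ℂ ((hubbardGridSub L M β (2 * (2 * M))).transpose * hubbardCovAboveCT L M β μ 0 0 klE0 *
              hubbardGridSub L M β (2 * (2 * M))) (((q', σ'), 0) : GridLeg (GridPoint L (2 * (2 * M)))) ((p', σ'), 1)) •
            (gen ℂ (((p', σ'), 0) : GridLeg (GridPoint L (2 * (2 * M)))) * gen ℂ (((q', σ'), 1) : GridLeg (GridPoint L (2 * (2 * M)))))) -
        (∑ p' : GridPoint L (2 * (2 * M)), ∑ σ' : Fin 2,
          ((2 : ℂ) * ((2 : ℂ)⁻¹ * (((U * (β / (2 * (2 * M) : ℕ)) : ℝ) : ℂ) *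
              (-∑ k : FreqMomentum L M, ((1 / (β * (L : ℝ) ^ 2) : ℝ) : ℂ) ^ 2 * uvSymbolCT L M β μ 0 klE0 (k, 0))) +
            (2 : ℂ)⁻¹ * (((U * (β / (2 * (2 * M) : ℕ)) : ℝ) : ℂ) ^ 2 *
              ((-∑ k : FreqMomentum L M, ((1 / (β * (L : ℝ) ^ 2) : ℝ) : ℂ) ^ 2 * uvSymbolCT L M β μ 0 klE0 (k, 0)) *
                ∑ q : GridPoint L (2 * (2 * M)),
                  contr ℂ ((hubbardGridSub L M β (2 * (2 * M))).transpose * hubbardCovAboveCT L M β μ 0 0 klE0 *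
                      hubbardGridSub L M β (2 * (2 * M))) (((p', σ'.rev), 0) : GridLeg (GridPoint L (2 * (2 * M)))) ((q, σ'.rev), 1) *
                    contr ℂ ((hubbardGridSub L M β (2 * (2 * M))).transpose * hubbardCovAboveCT L M β μ 0 0 klE0 *
                      hubbardGridSub L M β (2 * (2 * M))) (((q, σ'.rev), 0) : GridLeg (GridPoint L (2 * (2 * M)))) ((p', σ'.rev), 1))) -
            (2 : ℂ)⁻¹ * ((((U * (β / (2 * (2 * M) : ℕ)) : ℝ) : ℂ) ^ 2 *
                ((-∑ k : FreqMomentum L M, ((1 / (β * (L : ℝ) ^ 2) : ℝ) : ℂ) ^ 2 * uvSymbolCT L M β μ 0 klE0 (k, 0)) *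
                 (-∑ k : FreqMomentum L M, ((1 / (β * (L : ℝ) ^ 2) : ℝ) : ℂ) ^ 2 * uvSymbolCT L M β μ 0 klE0 (k, 0)))) *
              (-∑ k : FreqMomentum L M, ((1 / (β * (L : ℝ) ^ 2) : ℝ) : ℂ) ^ 2 * uvSymbolCT L M β μ 0 klE0 (k, 0))))) •
            (gen ℂ (((p', σ'), 0) : GridLeg (GridPoint L (2 * (2 * M)))) * gen ℂ (((p', σ'), 1) : GridLeg (GridPoint L (2 * (2 * M))))))) 2
        (fun i => ((![p, p] i, σ), i)) =
      kernel ℂ (effAction ℂ ((hubbardGridSub L M β (2 * (2 * M))).transpose * hubbardCovAboveCT L M β μ 0 0 klE0 *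
            hubbardGridSub L M β (2 * (2 * M))) (hubbardGridInteraction L (2 * (2 * M)) β U) -
          gaussConv ℂ ((hubbardGridSub L M β (2 * (2 * M))).transpose * hubbardCovAboveCT L M β μ 0 0 klE0 *
            hubbardGridSub L M β (2 * (2 * M))) (hubbardGridInteraction L (2 * (2 * M)) β U) +
        (2 : ℂ)⁻¹ • (gaussConv ℂ ((hubbardGridSub L M β (2 * (2 * M))).transpose * hubbardCovAboveCT L M β μ 0 0 klE0 *
              hubbardGridSub L M β (2 * (2 * M))) (hubbardGridInteraction L (2 * (2 * M)) β U * hubbardGridInteraction L (2 * (2 * M)) β U) -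
          gaussConv ℂ ((hubbardGridSub L M β (2 * (2 * M))).transpose * hubbardCovAboveCT L M β μ 0 0 klE0 *
              hubbardGridSub L M β (2 * (2 * M))) (hubbardGridInteraction L (2 * (2 * M)) β U) *
            gaussConv ℂ ((hubbardGridSub L M β (2 * (2 * M))).transpose * hubbardCovAboveCT L M β μ 0 0 klE0 *
              hubbardGridSub L M β (2 * (2 * M))) (hubbardGridInteraction L (2 * (2 * M)) β U))) 2
        (fun i => ((![p, p] i, σ), i)) := by
  rw [kernel_sub_apply, kernel_sub_apply, kernel_two_scaleZero_effAction_diag β U μ p σ, kernel_two_chainQuadratic β μ _ p p σ,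
    kernel_two_diagQuadratic, if_pos rfl, contr_scaleZeroGridCov_samePoint β μ p σ]
  ring

end Split

end Summit.HubbardSuperconductivity.HubbardSuperconductivity.Theorems.KLRegimeSplit

end
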